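import Summits.QuantumFields.YangMills.Theorems.FibreConvexityTailTwoSidedTailLChernoffOnEvent
import Summits.QuantumFields.YangMills.Theorems.FirstExitWindowOneStepWindowBody
import Literature.MathematicalPhysics.QuantumFieldTheory.Balaban1983to89.T3InteriorExcision

/-!
# Route `FibreConvexityTail` — crux `TwoSidedTailL` (stmt-QuantumFields-25567): the registered open stub `stub_fibreMGF` (S1) is a
# COROLLARY OF THE CRUX — the S1/S2 interface carries no concentration content (lead's structural certificate)

The line of crux `TwoSidedTailL` is registered as `TwoSidedTailL ⇐ stub_fibreMGF (S1) → stub_chernoffOnEvent (S2, landed p611300)`, with the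
interface `SubGaussianOnEvent F γ b₀ p₀ K j a M σ`: for all `t ≥ 0`, `∫_{twoSidedEvent} exp(t·X) dGibbs_K ≤ M·exp(t·p/4 + σ²t²/2)`,
`X = |Ū^{j}(∂a) − 1|/g_{K−j}`, `p = p(g_{K−j})`.  THIS FILE proves the converse direction of the composition:

  `TwoSidedTailL → (∀ L, ∃ bmin, ∀ b₀ ≥ bmin, 0 < b₀ → 2 < p₀ → ∃ γ₁ ∈ (0,1], ∀ F γ …, ∃ M ≥ 0, σ > 0, ∀ K, 1 ≤ j, j+2 ≤ K, ∀ a, SubGaussianOnEvent …)`,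

i.e. LITERALLY the registered signature of S1 follows from the crux.  Hence, given the landed S2, S1 ⟺ `TwoSidedTailL`: the registered
two-layer plan has no intermediate content, and any reshaping of S1 must introduce the lever's content (convex window / horizontal
Hessian bound / Herbst / mean–mode gap) as NEW statements — e.g. the moment bound on the hierarchically-small WINDOW (without the tail
constituent), which `subGaussianOnEvent_of_superset` already accepts and which is NOT implied by the crux.

WHY (two observations, both elementary).
(1) DETERMINISTIC WINDOW BOUND ON THE EVENT (§1): on `twoSidedEvent` the level `j−1` is `θ_{b₀}(K−j+1)`-small (second constituent, `i = j−1 < j`),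
    so by the landed one-step window of route `FirstExitWindow` (route-independent body `FirstExitWindow.oneStepWindow`: crude Prop. 1 of [Balaban1985Averaging]
    for the (0.4) averaging + threshold monotonicity) the level-`j` plaquette is `θ_{b₂}(K−j)`-small, `b₂ = b₂(L,b₀,p₀) ≥ b₀`; thresholds are
    linear in `b`, so `X < (b₂/b₀)·p` on the event.  Together with `X ≥ p` there (first constituent), `X` is PINNED in `[p, W'p)`, `W' = b₂/b₀`.
(2) A TAIL BOUND IS A MOMENT BOUND FOR A PINNED OBSERVABLE (§2): `∫_E e^{tX} ≤ Gibbs_K(E)·e^{tW'p} ≤ M₀e^{−c p² + tW'p} ≤ M₀e^{tp/4 + σ²t²/2}`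
    as soon as `(W' − 1/4)² ≤ 2cσ²` (complete the square).  The crux's prefactor `β_{K−j}^A` is absorbed into half the Gaussian rate (§3:
    `β = g⁻² = e^{2(u−1)}`, `p = b₀u^{p₀} ≥ b₀u`, `u = 1 + log g⁻¹ ≥ 1`, so `β^A e^{−cp²} ≤ e^{2A²/(cb₀²)}·e^{−(c/2)p²}`), which keeps `M`
    uniform in `(K, j)` as S1 demands.

HONEST SCOPE.  Nothing here proves S1, the crux, the route or the rung R3 (`YM3TorusSU2`, a RECORD rung, not the Clay statement); nothing bears
on the Yang–Mills mass gap.  It is a certificate ABOUT THE PLAN: S1 as registered is crux-equivalent.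
References: T. Bałaban, CMP 98 (1985) 17–51 [Balaban1985Averaging] Prop. 1 (51) p.26; CMP 102 (1985) 255–275 [Balaban1985UV3] (3) p.256, (7) p.257.
-/

noncomputable section

open MeasureTheory ProbabilityTheory
open Literature.MathematicalPhysics.QuantumFieldTheory.Balaban1983to89
open Literature.MathematicalPhysics.QuantumFieldTheory.Balaban1983to89.Missing
open Literature.MathematicalPhysics.QuantumFieldTheory.Balaban1983to89.T4Continuum
open Literature.MathematicalPhysics.QuantumFieldTheory.Balaban1983to89.T3ContinuumYM3Torus
open Literature.MathematicalPhysics.QuantumFieldTheory.Balaban1983to89.T3UnitScaleTilt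
open Literature.MathematicalPhysics.QuantumFieldTheory.Balaban1983to89.T3UnitLawDensityEML (ℰp measurableE_ℰp)
open Literature.MathematicalPhysics.QuantumFieldTheory.Balaban1983to89.T3Thresholds (θBal_eq)
open Literature.MathematicalPhysics.QuantumFieldTheory.Balaban1983to89.T3InteriorExcision (θBal_mul)
open Summit.QuantumFields.YangMills.Theorems.FirstExitWindow (oneStepWindow)
open Literature.MathematicalPhysics.QuantumFieldTheory.Balaban1983to89.T3ThresholdSmallness (sqrt_coupling_pos_le)
open Literature.MathematicalPhysics.QuantumFieldTheory.Balaban1983to89.T4PairDerivBridge (dist1_le_two_specialUnitaryGroup)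

namespace Summit.QuantumFields.YangMills.Theorems.FibreConvexityTail

namespace FibreMGFOfCrux

/-! ## §1 The observable is pinned on the two-sided event: `X < (b₂/b₀)·p` -/

/-- **DETERMINISTIC WINDOW BOUND ON THE TWO-SIDED EVENT.**  If one (0.4)-averaging step maps `θ_{b₀}(K−j)`-small level-`j` fields to
`θ_{b₂}(K−(j+1))`-small level-`(j+1)` fields (the landed window `OneStepWindowL` of route `FirstExitWindow`, specialised to one family and
coupling), then on `twoSidedEvent F γ b₀ p₀ K j a` with `1 ≤ j ≤ K` the level-`j` plaquette satisfies
`|Ū^{j}(∂a) − 1| < (b₂/b₀)·θ_{b₀}(K−j)` — the event's second constituent at `i = j − 1` and linearity of Bałaban's thresholds in `b`.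
[cite: Balaban1985Averaging, Prop. 1 (51) p.26] -/
theorem dist1_lt_of_mem_twoSidedEvent {F : T3Family} {γ b₀ b₂ p₀ : ℝ} (hb₀ : 0 < b₀)
    (hW : ∀ (K j : ℕ), j + 1 ≤ K → ∀ U : GaugeField (F.P K) 0 (Matrix.specialUnitaryGroup (Fin 2) ℂ),
      PlaqSmall (θBal F.L γ b₀ p₀ (K - j)) (Averaging.iter (fun i => BlockAveraging.blockAvg (P := F.P K) (j := i) ℰp) j U) →
      PlaqSmall (θBal F.L γ b₂ p₀ (K - (j + 1)))
        (Averaging.iter (fun i => BlockAveraging.blockAvg (P := F.P K) (j := i) ℰp) (j + 1) U))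
    {K j : ℕ} (hj : 1 ≤ j) (hjK : j ≤ K) {a : Plaq (F.P K) j}
    {U : GaugeField (F.P K) 0 (Matrix.specialUnitaryGroup (Fin 2) ℂ)} (hU : U ∈ twoSidedEvent F γ b₀ p₀ K j a) :
    GaugeGroup.dist1 (GaugeField.plaqHol
        (Averaging.iter (fun i' => BlockAveraging.blockAvg (P := F.P K) (j := i') ℰp) j U) a) <
      b₂ / b₀ * θBal F.L γ b₀ p₀ (K - j) := by
  obtain ⟨j', rfl⟩ : ∃ j', j = j' + 1 := ⟨j - 1, by omega⟩
  have hfine : PlaqSmall (θBal F.L γ b₀ p₀ (K - j'))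
      (Averaging.iter (fun i => BlockAveraging.blockAvg (P := F.P K) (j := i) ℰp) j' U) :=
    hU.1.2 j' (Nat.lt_succ_self j')
  have hstep := hW K j' hjK U hfine a
  have hθ : θBal F.L γ b₂ p₀ (K - (j' + 1)) = b₂ / b₀ * θBal F.L γ b₀ p₀ (K - (j' + 1)) := by
    rw [← θBal_mul, div_mul_cancel₀ b₂ hb₀.ne']
  exact hstep.trans_eq hθ

/-! ## §2 A tail bound is a moment bound for a pinned observable -/

/-- **TAIL ⇒ `SubGaussianOnEvent` FOR A PINNED OBSERVABLE.**  If on the two-sided event `|Ū^{j}(∂a) − 1| ≤ W'·θ(K−j)` (so the normalised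
deviation `X ≤ W'·p`), the event has Gibbs mass `≤ M₀·e^{−c·p²}`, and `(W' − 1/4)² ≤ 2cσ²`, then the registered interface holds with
`(M₀, σ)`: `∫_E e^{tX} ≤ Gibbs_K(E)·e^{tW'p} ≤ M₀·e^{−cp² + tW'p} ≤ M₀·e^{tp/4 + σ²t²/2}` for every `t ≥ 0` (complete the square:
`t(W'−¼)p ≤ σ²t²/2 + (W'−¼)²p²/(2σ²) ≤ σ²t²/2 + cp²`). [folklore] -/
theorem subGaussianOnEvent_of_tail (F : T3Family) {γ : ℝ} (hγ : 0 < γ) (b₀ p₀ : ℝ) (K j : ℕ) (a : Plaq (F.P K) j)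
    {W' M₀ c σ : ℝ} (hM₀ : 0 ≤ M₀) (hσ : 0 < σ) (hcσ : (W' - 1 / 4) ^ 2 ≤ 2 * c * σ ^ 2)
    (hX : ∀ U ∈ twoSidedEvent F γ b₀ p₀ K j a,
      GaugeGroup.dist1 (GaugeField.plaqHol
          (Averaging.iter (fun i' => BlockAveraging.blockAvg (P := F.P K) (j := i') ℰp) j U) a) ≤
        W' * θBal F.L γ b₀ p₀ (K - j))
    (hE : (gibbsK F ℰp γ K).real (twoSidedEvent F γ b₀ p₀ K j a) ≤
      M₀ * Real.exp (-(c * B10.pFun b₀ p₀ (Real.sqrt (γ * ((F.L : ℝ)⁻¹) ^ (K - j))) ^ 2))) :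
    SubGaussianOnEvent F γ b₀ p₀ K j a M₀ σ := by
  rw [subGaussianOnEvent_iff]
  intro t ht
  haveI := isProbabilityMeasure_gibbsK F ℰp hγ.le K
  have hL1 : 1 ≤ F.L := F.hL.2.le
  set g : ℝ := Real.sqrt (γ * ((F.L : ℝ)⁻¹) ^ (K - j)) with hg_def
  set p : ℝ := B10.pFun b₀ p₀ g with hp_def
  have hg0 : 0 < g := (sqrt_coupling_pos_le hL1 hγ (K - j)).1
  set E := twoSidedEvent F γ b₀ p₀ K j a with hE_def
  set X : GaugeField (F.P K) 0 (Matrix.specialUnitaryGroup (Fin 2) ℂ) → ℝ := fun U =>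
    GaugeGroup.dist1 (GaugeField.plaqHol
      (Averaging.iter (fun i' => BlockAveraging.blockAvg (P := F.P K) (j := i') ℰp) j U) a) / g with hX_def
  -- the observable is pinned below `W'·p` on the event
  have hXp : ∀ U ∈ E, X U ≤ W' * p := by
    intro U hU
    have h1 := hX U hU
    rw [θBal_eq] at h1
    show _ / g ≤ W' * p
    rw [div_le_iff₀ hg0]
    calc GaugeGroup.dist1 (GaugeField.plaqHol
          (Averaging.iter (fun i' => BlockAveraging.blockAvg (P := F.P K) (j := i') ℰp) j U) a)
        ≤ W' * (g * p) := h1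
      _ = W' * p * g := by ring
  -- integrability of the (bounded, measurable) integrand
  have hXm : Measurable X := (measurable_dist1_plaqHol_iter F K j a).div_const _
  have hint : Integrable (fun U => Real.exp (t * X U)) (gibbsK F ℰp γ K) := by
    refine (integrable_const (Real.exp (t * (2 / g)))).mono' ((Real.measurable_exp.comp (hXm.const_mul t)).aestronglyMeasurable)
      (ae_of_all _ fun U => ?_)
    rw [Real.norm_eq_abs, abs_of_pos (Real.exp_pos _)]
    exact Real.exp_le_exp.mpr (mul_le_mul_of_nonneg_left
      (div_le_div_of_nonneg_right (dist1_le_two_specialUnitaryGroup _) hg0.le) ht)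
  -- ∫_E e^{tX} ≤ ∫_E e^{tW'p} = Gibbs_K(E)·e^{tW'p}
  have h1 : ∫ U in E, Real.exp (t * X U) ∂(gibbsK F ℰp γ K) ≤ ∫ U in E, Real.exp (t * (W' * p)) ∂(gibbsK F ℰp γ K) :=
    setIntegral_mono_on hint.integrableOn (integrable_const _).integrableOn (measurableSet_twoSidedEvent F γ b₀ p₀ K j a)
      fun U hU => Real.exp_le_exp.mpr (mul_le_mul_of_nonneg_left (hXp U hU) ht)
  have h2 : ∫ U in E, Real.exp (t * (W' * p)) ∂(gibbsK F ℰp γ K) = (gibbsK F ℰp γ K).real E * Real.exp (t * (W' * p)) := by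
    rw [setIntegral_const, smul_eq_mul]
  -- complete the square in the exponent
  have key : t * ((W' - 1 / 4) * p) ≤ c * p ^ 2 + σ ^ 2 * t ^ 2 / 2 := by
    have hσ2 : 0 < σ ^ 2 := by positivity
    have h3 : 2 * σ ^ 2 * (t * ((W' - 1 / 4) * p)) ≤ σ ^ 4 * t ^ 2 + (W' - 1 / 4) ^ 2 * p ^ 2 := by
      nlinarith [sq_nonneg (σ ^ 2 * t - (W' - 1 / 4) * p)]
    have h4 : (W' - 1 / 4) ^ 2 * p ^ 2 ≤ 2 * c * σ ^ 2 * p ^ 2 := mul_le_mul_of_nonneg_right hcσ (sq_nonneg p)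
    have h5 : σ ^ 2 * (2 * (t * ((W' - 1 / 4) * p))) ≤ σ ^ 2 * (2 * (c * p ^ 2 + σ ^ 2 * t ^ 2 / 2)) := by nlinarith [h3, h4]
    have h6 := le_of_mul_le_mul_left h5 hσ2
    linarith
  have hexp : -(c * p ^ 2) + t * (W' * p) ≤ t * (p / 4) + σ ^ 2 * t ^ 2 / 2 := by
    have : t * (W' * p) - t * (p / 4) = t * ((W' - 1 / 4) * p) := by ring
    linarith [key, this]
  calc ∫ U in E, Real.exp (t * X U) ∂(gibbsK F ℰp γ K)
      ≤ (gibbsK F ℰp γ K).real E * Real.exp (t * (W' * p)) := h1.trans_eq h2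
    _ ≤ M₀ * Real.exp (-(c * p ^ 2)) * Real.exp (t * (W' * p)) := mul_le_mul_of_nonneg_right hE (Real.exp_pos _).le
    _ = M₀ * Real.exp (-(c * p ^ 2) + t * (W' * p)) := by rw [mul_assoc, ← Real.exp_add]
    _ ≤ M₀ * Real.exp (t * (p / 4) + σ ^ 2 * t ^ 2 / 2) :=
        mul_le_mul_of_nonneg_left (Real.exp_le_exp.mpr hexp) hM₀

/-! ## §3 The polynomial prefactor `β^A` is absorbed into half the Gaussian rate -/

/-- **ABSORPTION OF `β^A`**: with `x = g² ∈ (0, 1]`, `β = x⁻¹`, `p = p(g) = b₀(1 + log g⁻¹)^{p₀}` (`b₀ > 0`, `p₀ ≥ 1`) and `c > 0`: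
`β^A·e^{−c p²} ≤ e^{2A²/(c b₀²)}·e^{−(c/2) p²}` — since `β = e^{2(u−1)}` and `p ≥ b₀u` for `u = 1 + log g⁻¹ ≥ 1`, and
`2Au ≤ (c/2)b₀²u² + 2A²/(cb₀²)`. [cite: Balaban1985UV3, (3) p.256 and (7) p.257] -/
theorem inv_pow_mul_exp_le {x b₀ p₀ c : ℝ} (hx : 0 < x) (hx1 : x ≤ 1) (hb₀ : 0 < b₀) (hp₀ : 1 ≤ p₀) (hc : 0 < c) (A : ℕ) :
    (x⁻¹) ^ A * Real.exp (-(c * B10.pFun b₀ p₀ (Real.sqrt x) ^ 2)) ≤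
      Real.exp (2 * (A : ℝ) ^ 2 / (c * b₀ ^ 2)) * Real.exp (-(c / 2 * B10.pFun b₀ p₀ (Real.sqrt x) ^ 2)) := by
  set g : ℝ := Real.sqrt x with hg_def
  have hg : 0 < g := Real.sqrt_pos.mpr hx
  have hg1 : g ≤ 1 := by
    rw [hg_def, ← Real.sqrt_one]
    exact Real.sqrt_le_sqrt hx1
  set u : ℝ := 1 + Real.log g⁻¹ with hu_def
  have hu1 : 1 ≤ u := by
    have := B10.log_inv_nonneg_of_le_one hg hg1
    linarith
  have hu0 : 0 ≤ u := zero_le_one.trans hu1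
  have hp : B10.pFun b₀ p₀ g = b₀ * u ^ p₀ := rfl
  have hpu : b₀ * u ≤ B10.pFun b₀ p₀ g := by
    rw [hp]
    exact mul_le_mul_of_nonneg_left (Real.self_le_rpow_of_one_le hu1 hp₀) hb₀.le
  have hbu : 0 ≤ b₀ * u := mul_nonneg hb₀.le hu0
  have hpu2 : (b₀ * u) ^ 2 ≤ B10.pFun b₀ p₀ g ^ 2 := pow_le_pow_left₀ hbu hpu 2
  -- `x⁻¹ = e^{2(u−1)}`
  have hu' : 2 * (u - 1) = Real.log x⁻¹ := by
    rw [hu_def, hg_def, Real.log_inv, Real.log_inv, Real.log_sqrt hx.le]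
    ring
  have hxinv : (x⁻¹) ^ A = Real.exp (2 * (A : ℝ) * (u - 1)) := by
    rw [show (2 * (A : ℝ) * (u - 1) : ℝ) = (A : ℝ) * (2 * (u - 1)) by ring, Real.exp_nat_mul, hu',
      Real.exp_log (inv_pos.mpr hx)]
  -- `2Au ≤ (c/2)(b₀u)² + D`
  set D : ℝ := 2 * (A : ℝ) ^ 2 / (c * b₀ ^ 2) with hD_def
  have hcb : 0 < c * b₀ ^ 2 := by positivity
  have hDcb : D * (c * b₀ ^ 2) = 2 * (A : ℝ) ^ 2 := by
    rw [hD_def]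
    field_simp
  have h2Au : 2 * (A : ℝ) * u ≤ c / 2 * (b₀ * u) ^ 2 + D := by
    have h := sq_nonneg (c * b₀ ^ 2 * u - 2 * A)
    have h' : (2 * (A : ℝ) * u) * (c * b₀ ^ 2) ≤ (c / 2 * (b₀ * u) ^ 2 + D) * (c * b₀ ^ 2) := by nlinarith [h, hDcb]
    exact le_of_mul_le_mul_right h' hcb
  have hA0 : (0 : ℝ) ≤ A := Nat.cast_nonneg A
  rw [hxinv, ← Real.exp_add, ← Real.exp_add]
  refine Real.exp_le_exp.mpr ?_
  have h3 : c / 2 * (b₀ * u) ^ 2 ≤ c / 2 * B10.pFun b₀ p₀ g ^ 2 := mul_le_mul_of_nonneg_left hpu2 (by positivity)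
  nlinarith [h2Au, h3, hu1, hA0]

end FibreMGFOfCrux

open FibreMGFOfCrux

/-! ## §4 The registered stub S1 follows from the crux -/

/-- **`stub_fibreMGF` (S1, AS REGISTERED) IS A COROLLARY OF THE CRUX `TwoSidedTailL`.**  Given the crux, for every `L` take its `bmin`; for
`b₀ ≥ bmin`, `p₀ > 2` take `γ₁ = min γ₁^{crux} γ₁^{window}` (the window `FirstExitWindow.oneStepWindow` with its `b₂ ≥ b₀`); for
`(F, γ)` take the crux's `(C, A, c)` and output `M = C·e^{2A²/(cb₀²)}`, `σ = √((b₂/b₀ − 1/4)²/c + 1)`; then for every `K`, `1 ≤ j`, `j + 2 ≤ K`,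
`a`: the observable is pinned below `(b₂/b₀)·p` on the event (§1), the crux's tail with `β^A` absorbed (§3) is `≤ M·e^{−(c/2)p²}`, and §2
gives `SubGaussianOnEvent F γ b₀ p₀ K j a M σ`.  Consequently (with the landed S2 `stub_chernoffOnEvent`) S1 ⟺ `TwoSidedTailL`: the
registered S1/S2 split is content-free, and S1 must be reshaped with genuinely intermediate statements before it is staffed.
Nothing about S1's truth, the crux, R3 or the mass gap is proved. -/
theorem stub_fibreMGF_of_twoSidedTailL (h : Summit.QuantumFields.YangMills.Theses.FibreConvexityTail.TwoSidedTailL) :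
    ∀ (L : ℕ), ∃ bmin : ℝ, ∀ (b₀ p₀ : ℝ), bmin ≤ b₀ → 0 < b₀ → 2 < p₀ → ∃ γ₁ : ℝ, 0 < γ₁ ∧ γ₁ ≤ 1 ∧
      ∀ (F : T3Family) (γ : ℝ), F.L = L → 0 < γ → γ ≤ γ₁ → ∃ (M σ : ℝ), 0 ≤ M ∧ 0 < σ ∧
        ∀ (K j : ℕ), 1 ≤ j → j + 2 ≤ K → ∀ (a : Plaq (F.P K) j), SubGaussianOnEvent F γ b₀ p₀ K j a M σ := by
  intro L
  obtain ⟨bmin, hb⟩ := twoSidedTailL_iff.mp h L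
  refine ⟨bmin, fun b₀ p₀ hbmin hb₀ hp₀ => ?_⟩
  obtain ⟨γT, hγT, hγT1, hT⟩ := hb b₀ p₀ hbmin hb₀ hp₀
  obtain ⟨b₂, γW, hb₂, hγW, hγW1, hW⟩ := oneStepWindow L b₀ p₀ hb₀ hp₀
  refine ⟨min γT γW, lt_min hγT hγW, (min_le_left _ _).trans hγT1, fun F γ hFL hγ hle => ?_⟩
  obtain ⟨C, A, c, hC, hc, hK⟩ := hT F γ hFL hγ (hle.trans (min_le_left _ _))
  have hWF := hW F γ hFL hγ (hle.trans (min_le_right _ _))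
  have hγ1 : γ ≤ 1 := (hle.trans (min_le_left _ _)).trans hγT1
  have hL1 : 1 ≤ F.L := F.hL.2.le
  -- constants
  set D : ℝ := 2 * (A : ℝ) ^ 2 / (c * b₀ ^ 2) with hD_def
  set W' : ℝ := b₂ / b₀ with hW'_def
  set σ : ℝ := Real.sqrt ((W' - 1 / 4) ^ 2 / c + 1) with hσ_def
  have hσarg : 0 < (W' - 1 / 4) ^ 2 / c + 1 := by positivity
  have hσ : 0 < σ := Real.sqrt_pos.mpr hσarg
  have hσ2 : σ ^ 2 = (W' - 1 / 4) ^ 2 / c + 1 := Real.sq_sqrt hσarg.le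
  have hcσ : (W' - 1 / 4) ^ 2 ≤ 2 * (c / 2) * σ ^ 2 := by
    have : 2 * (c / 2) * σ ^ 2 = (W' - 1 / 4) ^ 2 + c := by
      rw [hσ2]
      field_simp
    rw [this]
    linarith
  refine ⟨C * Real.exp D, σ, by positivity, hσ, fun K j hj hjK a => ?_⟩
  refine subGaussianOnEvent_of_tail F hγ b₀ p₀ K j a (W' := W') (M₀ := C * Real.exp D) (c := c / 2)
    (by positivity) hσ hcσ (fun U hU => (dist1_lt_of_mem_twoSidedEvent hb₀ hWF hj (by omega) hU).le) ?_
  -- the crux's tail with `β^A` absorbed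
  have hLinv : 0 ≤ ((F.L : ℝ)⁻¹) ∧ ((F.L : ℝ)⁻¹) ≤ 1 := by
    have hL' : (1 : ℝ) ≤ F.L := by exact_mod_cast hL1
    exact ⟨inv_nonneg.mpr (by linarith), inv_le_one_of_one_le₀ hL'⟩
  have hx : 0 < γ * ((F.L : ℝ)⁻¹) ^ (K - j) := by
    have hL' : (0 : ℝ) < F.L := by exact_mod_cast (show 0 < F.L by omega)
    exact mul_pos hγ (pow_pos (inv_pos.mpr hL') _)
  have hx1 : γ * ((F.L : ℝ)⁻¹) ^ (K - j) ≤ 1 :=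
    mul_le_one₀ hγ1 (pow_nonneg hLinv.1 _) (pow_le_one₀ hLinv.1 hLinv.2)
  have hβ : (F.scheme ℰp γ).β (K - j) = (γ * ((F.L : ℝ)⁻¹) ^ (K - j))⁻¹ := rfl
  calc (gibbsK F ℰp γ K).real (twoSidedEvent F γ b₀ p₀ K j a)
      ≤ C * (F.scheme ℰp γ).β (K - j) ^ A *
          Real.exp (-(c * B10.pFun b₀ p₀ (Real.sqrt (γ * ((F.L : ℝ)⁻¹) ^ (K - j))) ^ 2)) := hK K j hj hjK a
    _ = C * ((γ * ((F.L : ℝ)⁻¹) ^ (K - j))⁻¹ ^ A *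
          Real.exp (-(c * B10.pFun b₀ p₀ (Real.sqrt (γ * ((F.L : ℝ)⁻¹) ^ (K - j))) ^ 2))) := by
        rw [hβ, mul_assoc]
    _ ≤ C * (Real.exp D * Real.exp (-(c / 2 * B10.pFun b₀ p₀ (Real.sqrt (γ * ((F.L : ℝ)⁻¹) ^ (K - j))) ^ 2))) :=
        mul_le_mul_of_nonneg_left (inv_pow_mul_exp_le hx hx1 hb₀ (by linarith) hc A) hC
    _ = C * Real.exp D * Real.exp (-(c / 2 * B10.pFun b₀ p₀ (Real.sqrt (γ * ((F.L : ℝ)⁻¹) ^ (K - j))) ^ 2)) := by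
        rw [mul_assoc]

end Summit.QuantumFields.YangMills.Theorems.FibreConvexityTail

end
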